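import Mathlib.MeasureTheory.Integral.Layercake
import Literature.Probability.LatticeModels.StrongMixingOfSMT
import HarnessLib

/-!
# Strong mixing on all multiples of `Q_{L₀}` ⇒ `SMT` on the multiples of `Q_{L₀}` inside `B_{2L}`
# ([Mar99] Theorem 2.7, (i) ⇒ (ii), the finite-volume step), PROVED; Theorem 2.7 modulo Proposition 2.9

Topic `Literature/Probability/LatticeModels`; cell `ym-ir`, seat lit-3 (census rows B2/B4).  Theorems only, no
new named fact (D-0026).  With `StrongMixingOfSMT.lean` ((ii) ⇒ (i)) this file reduces the typed fact
`Martinelli1999_strongMixing_iff_SMT` ([Mar99] Theorem 2.7, `StrongMixingFiniteSize.lean`) to the typed fact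
`Martinelli1999_effectiveness` ([Mar99] Proposition 2.9): `Glauber.strongMixing_iff_SMT_of_effectiveness`.
Proposition 2.9 itself (and its Lemma 2.10) is NOT proved here.  SIBLING-SETTING result (finite-range
interactions, `±1` spins on `ℤ^d`); nothing here is a statement about gauge theories, and the Yang–Mills mass gap
is not touched by it.

Source (held; `book:bertoin1999-lectures-probability-theory-statistics`): [Mar99] F. Martinelli, *Lectures on
Glauber dynamics for discrete spin models*, LNM 1717 (1999), Theorem 2.7 p0158 L19–26 and the proof of
(i) ⇒ (ii), p0159 L1–28, (2.8)–(2.11). [cite: Martinelli1999, Theorem 2.7]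

Contents:
* `mem_cubeQ_smul_add`, `isMultipleOf_of_mul`, `mem_classF_of_mem_classF0_mul` — a multiple of `Q_{L₀k}` is a
  multiple of `Q_{L₀}` (`𝓕_{L₀k}^0 ⊆ 𝓕_{L₀k} ⊆ 𝓕_{L₀}`), used to feed (i) at scale `L₀` into Proposition 2.9 at
  scale `l = L₀k` («we choose `L` in such a way that `Q_L` is a multiple of `Q_{L₀}`», p0159 L1–2).
* `Glauber.abs_bavg_spinFlip_sub_le_of_strongMixing` — `SM(W, C, m)` controls bounded local OBSERVABLES under a
  boundary flip: `|μ_W^{ζ^y}(g) − μ_W^ζ(g)| ≤ 2‖g‖ C e^{−m D}` when `g` does not read `y` and `Λ_g ∩ W` is at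
  distance `≥ D` from `y` (events ⇒ observables by the layer-cake formula; the spins of `g` off `W` are frozen
  by the boundary condition).
* `Glauber.SMT_of_strongMixing` — **(i) ⇒ (ii), finite-volume step**: `SM` on `𝓕_{L₀}` gives `L̄` with
  `SMT(Λ, L/2, m/2)` for all `L ≥ L̄` and all `Λ ∈ 𝓕_{L₀}` inside `B_{2L}` — (2.9) by the DLR equations with
  `W = Λ_{I_f^c}`, (2.10) by telescoping over `Λ_{I_f}`, (2.11) by `SM(W, C, m)` and `|Λ_{I_f}| ≤ (4L+1)^d`.
  Deviation from the print: blocks of side `L₀` (not `l₁ ∈ [L^{2/3}, L/8]`) and rate `m/2` (print: `m/8`); the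
  typed statements quantify these constants existentially.
* `Glauber.strongMixing_iff_SMT_of_effectiveness` — **Theorem 2.7 assuming Proposition 2.9**:
  `Martinelli1999_effectiveness U → Martinelli1999_strongMixing_iff_SMT U`.
-/

open MeasureTheory ProbabilityTheory Finset Filter Topology

noncomputable section

namespace Literature.Probability.LatticeModels

variable {d : ℕ}

/-! ### Multiples of `Q_{L₀k}` are multiples of `Q_{L₀}` -/

section Cubes

/-- Membership in the lattice cube `Q_L(Lx + o)`, coordinatewise. [cite: Martinelli1999, §2.1] -/
theorem mem_cubeQ_smul_add {L : ℕ} {x o z : Site d} :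
    z ∈ cubeQ L (L • x + o) ↔ ∀ i, (L : ℤ) * x i + o i ≤ z i ∧ z i < (L : ℤ) * x i + o i + L := by
  rw [mem_cubeQ]
  simp only [Pi.add_apply, nsmul_eq_mul, Pi.mul_apply, Pi.natCast_apply]

/-- A multiple of `Q_{L₀k}` is a multiple of `Q_{L₀}` (each cube `Q_{L₀k}(L₀k·x + o)` is the union of the
`k^d` cubes `Q_{L₀}(L₀(kx + j + ⌊o/L₀⌋) + (o mod L₀))`, `j ∈ [0,k)^d`). [cite: Martinelli1999, §2.1] -/
theorem isMultipleOf_of_mul {L₀ k : ℕ} (hL₀ : 0 < L₀) {Λ : Finset (Site d)} (h : IsMultipleOf (L₀ * k) Λ) :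
    IsMultipleOf L₀ Λ := by
  classical
  obtain ⟨o, ho, I, rfl⟩ := h
  have hL₀' : (0 : ℤ) < L₀ := by exact_mod_cast hL₀
  have key : ∀ i, o i % (L₀ : ℤ) + (L₀ : ℤ) * (o i / (L₀ : ℤ)) = o i := fun i => Int.emod_add_mul_ediv _ _
  have e : ∀ (x j : Site d) (i : Fin d), (L₀ : ℤ) * ((k : ℤ) * x i + j i + o i / (L₀ : ℤ)) + o i % (L₀ : ℤ) =
      (L₀ : ℤ) * k * x i + o i + (L₀ : ℤ) * j i := fun x j i => by linear_combination key i
  refine ⟨fun i => o i % (L₀ : ℤ), fun i => ⟨Int.emod_nonneg _ hL₀'.ne', Int.emod_lt_of_pos _ hL₀'⟩,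
    (I ×ˢ Fintype.piFinset fun _ : Fin d => Finset.Ico (0 : ℤ) k).image
      (fun p => fun i => (k : ℤ) * p.1 i + p.2 i + o i / (L₀ : ℤ)), ?_⟩
  ext z
  constructor
  · intro hz
    obtain ⟨x, hx, hzx⟩ := Finset.mem_biUnion.1 hz
    have hz' := mem_cubeQ_smul_add.1 hzx
    have hb : ∀ i, (L₀ : ℤ) * k * x i + o i ≤ z i ∧ z i < (L₀ : ℤ) * k * x i + o i + (L₀ : ℤ) * k := fun i => by
      have h := hz' i
      push_cast at h
      exact h
    set j : Site d := fun i => (z i - ((L₀ : ℤ) * k * x i + o i)) / (L₀ : ℤ) with hj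
    have hj' : ∀ i, (z i - ((L₀ : ℤ) * k * x i + o i)) % (L₀ : ℤ) + (L₀ : ℤ) * j i =
        z i - ((L₀ : ℤ) * k * x i + o i) := fun i => Int.emod_add_mul_ediv _ _
    have hrem0 : ∀ i, 0 ≤ (z i - ((L₀ : ℤ) * k * x i + o i)) % (L₀ : ℤ) := fun i =>
      Int.emod_nonneg _ hL₀'.ne'
    have hremL : ∀ i, (z i - ((L₀ : ℤ) * k * x i + o i)) % (L₀ : ℤ) < L₀ := fun i =>
      Int.emod_lt_of_pos _ hL₀'
    refine Finset.mem_biUnion.2 ⟨fun i => (k : ℤ) * x i + j i + o i / (L₀ : ℤ), Finset.mem_image.2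
      ⟨(x, j), Finset.mem_product.2 ⟨hx, Fintype.mem_piFinset.2 fun i => Finset.mem_Ico.2 ⟨?_, ?_⟩⟩, rfl⟩,
      mem_cubeQ_smul_add.2 fun i => ?_⟩
    · exact Int.ediv_nonneg (by linarith [(hb i).1]) hL₀'.le
    · show (z i - ((L₀ : ℤ) * k * x i + o i)) / (L₀ : ℤ) < k
      rw [Int.ediv_lt_iff_lt_mul hL₀']
      linarith [(hb i).2]
    · rw [e]
      constructor <;> linarith [hj' i, hrem0 i, hremL i, (hb i).1, (hb i).2]
  · intro hz
    obtain ⟨x', hx', hzx'⟩ := Finset.mem_biUnion.1 hz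
    obtain ⟨⟨x, j⟩, hp, rfl⟩ := Finset.mem_image.1 hx'
    obtain ⟨hx, hj⟩ := Finset.mem_product.1 hp
    have hjk : ∀ i, 0 ≤ j i ∧ j i < k := fun i => Finset.mem_Ico.1 (Fintype.mem_piFinset.1 hj i)
    have hz' := mem_cubeQ_smul_add.1 hzx'
    refine Finset.mem_biUnion.2 ⟨x, hx, mem_cubeQ_smul_add.2 fun i => ?_⟩
    have h := hz' i
    simp only [] at h
    rw [e] at h
    push_cast
    have hj0 : 0 ≤ (L₀ : ℤ) * j i := mul_nonneg hL₀'.le (hjk i).1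
    have hj1 : (L₀ : ℤ) * j i + L₀ ≤ (L₀ : ℤ) * k := by nlinarith [(hjk i).2, hL₀']
    constructor <;> linarith [h.1, h.2]

/-- The finite class is part of the full class at the finer scale: `𝓕_{L₀k}^0 ∋ V ⇒ V ∈ 𝓕_{L₀}`.
[cite: Martinelli1999, §2.4] -/
theorem mem_classF_of_mem_classF0_mul {L₀ k : ℕ} (hL₀ : 0 < L₀) {V : Finset (Site d)}
    (hV : V ∈ classF0 d (L₀ * k)) : V ∈ classF d L₀ :=
  isMultipleOf_of_mul hL₀ hV.1

end Cubes

/-! ### From events to observables -/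

section Observables

/-- If two probability measures are `ε`-close on all `T`-local events, then they are `2Bε`-close on every
`T`-local observable bounded by `B` (layer-cake formula applied to `u + B ∈ [0, 2B]`). [folklore] -/
private theorem abs_integral_sub_integral_le_of_local {μ ν : Measure (Site d → ℤˣ)} [IsProbabilityMeasure μ]
    [IsProbabilityMeasure ν] {u : (Site d → ℤˣ) → ℝ} (hu : Measurable u) {T : Set (Site d)}
    (hdu : DependsOn u T) {B : ℝ} (hB : ∀ σ, |u σ| ≤ B) {ε : ℝ}
    (hev : ∀ A : Set (Site d → ℤˣ), MeasurableSet A → DependsOn (· ∈ A) T → |μ.real A - ν.real A| ≤ ε) :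
    |∫ σ, u σ ∂μ - ∫ σ, u σ ∂ν| ≤ 2 * B * ε := by
  have hB0 : 0 ≤ B := (abs_nonneg _).trans (hB fun _ => 1)
  set v : (Site d → ℤˣ) → ℝ := fun σ => u σ + B with hv
  have hvm : Measurable v := hu.add_const B
  have hv0 : ∀ σ, 0 ≤ v σ := fun σ => by
    have h := hB σ
    rw [abs_le] at h
    simp only [hv]
    linarith
  have hvM : ∀ σ, v σ ≤ 2 * B := fun σ => by
    have h := hB σ
    rw [abs_le] at h
    simp only [hv]
    linarith
  have hiu : ∀ (ρ : Measure (Site d → ℤˣ)) [IsProbabilityMeasure ρ], Integrable u ρ := fun ρ _ =>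
    Integrable.of_bound hu.aestronglyMeasurable B (Eventually.of_forall fun σ => by
      rw [Real.norm_eq_abs]; exact hB σ)
  have hiv : ∀ (ρ : Measure (Site d → ℤˣ)) [IsProbabilityMeasure ρ], Integrable v ρ := fun ρ _ =>
    (hiu ρ).add (integrable_const B)
  have hlc : ∀ (ρ : Measure (Site d → ℤˣ)) [IsProbabilityMeasure ρ],
      ∫ σ, u σ ∂ρ = (∫ t in Set.Ioc 0 (2 * B), ρ.real {a | t ≤ v a}) - B := by
    intro ρ _
    rw [← (hiv ρ).integral_eq_integral_Ioc_meas_le (Eventually.of_forall hv0) (Eventually.of_forall hvM)]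
    simp only [hv]
    rw [integral_add (hiu ρ) (integrable_const B), integral_const, smul_eq_mul, probReal_univ, one_mul]
    ring
  rw [hlc μ, hlc ν]
  -- the level sets `{t ≤ v}` are `T`-local events
  have hloc : ∀ t : ℝ, |μ.real {a | t ≤ v a} - ν.real {a | t ≤ v a}| ≤ ε := fun t =>
    hev _ (measurableSet_le measurable_const hvm) fun σ σ' h => by
      simp only [Set.mem_setOf_eq, hv]
      rw [hdu h]
  have hε : 0 ≤ ε := (abs_nonneg _).trans (hloc 0)
  have hanti : ∀ (ρ : Measure (Site d → ℤˣ)) [IsProbabilityMeasure ρ],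
      Measurable fun t : ℝ => ρ.real {a | t ≤ v a} := fun ρ _ =>
    Antitone.measurable fun s t hst => measureReal_mono fun a (ha : t ≤ v a) => hst.trans ha
  haveI : IsFiniteMeasure (volume.restrict (Set.Ioc (0 : ℝ) (2 * B))) :=
    isFiniteMeasure_restrict.2 measure_Ioc_lt_top.ne
  have hint : ∀ (ρ : Measure (Site d → ℤˣ)) [IsProbabilityMeasure ρ],
      Integrable (fun t : ℝ => ρ.real {a | t ≤ v a}) (volume.restrict (Set.Ioc (0 : ℝ) (2 * B))) :=
    fun ρ _ => Integrable.of_bound (hanti ρ).aestronglyMeasurable 1 (Eventually.of_forall fun t => by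
      rw [Real.norm_eq_abs, abs_of_nonneg measureReal_nonneg]; exact measureReal_le_one)
  rw [sub_sub_sub_cancel_right, ← integral_sub (hint μ) (hint ν)]
  calc |∫ t in Set.Ioc 0 (2 * B), (μ.real {a | t ≤ v a} - ν.real {a | t ≤ v a})|
      ≤ ε * volume.real (Set.Ioc (0 : ℝ) (2 * B)) := by
        refine (Real.norm_eq_abs _).symm.trans_le (norm_setIntegral_le_of_norm_le_const measure_Ioc_lt_top
          fun t _ => ?_)
        rw [Real.norm_eq_abs]
        exact hloc t
    _ = 2 * B * ε := by
        rw [Real.volume_real_Ioc_of_le (by positivity), sub_zero, mul_comm]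

/-- Telescoping over single-site updates: if every single-site change of the configuration inside `S` moves
`Φ` by at most `b`, then replacing the configuration on `S` moves `Φ` by at most `|S| b`. [folklore] -/
private theorem abs_sub_le_card_mul {Φ : (Site d → ℤˣ) → ℝ} (S : Finset (Site d)) {b : ℝ}
    (hstep : ∀ (ζ : Site d → ℤˣ), ∀ y ∈ S, ∀ s : ℤˣ, |Φ (Function.update ζ y s) - Φ ζ| ≤ b)
    (η η' : Site d → ℤˣ) : |Φ (S.piecewise η' η) - Φ η| ≤ S.card * b := by
  classical
  have hind : ∀ S' : Finset (Site d), S' ⊆ S → |Φ (S'.piecewise η' η) - Φ η| ≤ S'.card * b := by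
    intro S'
    induction S' using Finset.induction_on with
    | empty =>
      intro _
      simp
    | insert y S' hyS' ih =>
      intro hsub
      have hy : y ∈ S := hsub (Finset.mem_insert_self y S')
      have hsub' : S' ⊆ S := fun x hx => hsub (Finset.mem_insert_of_mem hx)
      rw [Finset.piecewise_insert, Finset.card_insert_of_notMem hyS']
      calc |Φ (Function.update (S'.piecewise η' η) y (η' y)) - Φ η|
          ≤ |Φ (Function.update (S'.piecewise η' η) y (η' y)) - Φ (S'.piecewise η' η)| +
            |Φ (S'.piecewise η' η) - Φ η| := abs_sub_le _ _ _
        _ ≤ b + S'.card * b := add_le_add (hstep _ y hy _) (ih hsub')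
        _ = ((S'.card + 1 : ℕ) : ℝ) * b := by push_cast; ring
  convert hind S Finset.Subset.rfl using 2

end Observables

namespace Glauber

variable {r : ℕ}

/-! ### One boundary flip under strong mixing -/

/-- **Strong mixing controls observables under a boundary flip**: if `SM(W, C, m)` holds, `g` (bounded by
`B_g`, reading the spins in `Λ_g`) does not read the site `y ∉ W`, and every site of `Λ_g ∩ W` is at distance
`≥ D` from `y`, then `|μ_W^{ζ^y}(g) − μ_W^ζ(g)| ≤ 2 B_g C e^{−mD}`: the spins of `g` outside `W` are frozen by
the boundary condition (the same for `ζ` and `ζ^y`, as `g` does not read `y`), and the frozen observable is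
`Λ_g ∩ W`-local ([Mar99] p0159, the step from (2.10) to (2.11): «apply property SM(C, m, Λ_{I_f^c}) to
estimate each term»). [cite: Martinelli1999, Theorem 2.7, proof, (2.10)–(2.11)] -/
theorem abs_bavg_spinFlip_sub_le_of_strongMixing {γ : Specification (Site d) ℤˣ} (hγ : IsSpecification γ)
    {W : Finset (Site d)} {C m : ℝ} (hC : 0 ≤ C) (hm : 0 ≤ m) (hSM : StrongMixing γ W C m)
    {g : (Site d → ℤˣ) → ℝ} (hg : Measurable g) {Λg : Finset (Site d)}
    (hdg : DependsOn g (↑Λg : Set (Site d))) {Bg : ℝ} (hBg : ∀ σ, |g σ| ≤ Bg) {y : Site d} (hyW : y ∉ W)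
    (hyg : y ∉ Λg) {D : ℝ} (hD : ∀ z ∈ Λg, z ∈ W → D ≤ (supDist z y : ℝ)) (ζ : Site d → ℤˣ) :
    |bavg γ W g (spinFlip y ζ) - bavg γ W g ζ| ≤ 2 * Bg * (C * Real.exp (-(m * D))) := by
  classical
  haveI := hγ.isProbability W ζ
  haveI := hγ.isProbability W (spinFlip y ζ)
  have hBg0 : 0 ≤ Bg := (abs_nonneg _).trans (hBg ζ)
  -- freeze the spins off `W` at `ζ`
  set gζ : (Site d → ℤˣ) → ℝ := fun ω => g (W.piecewise ω ζ) with hgζ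
  have hpw : Measurable fun ω : Site d → ℤˣ => W.piecewise ω ζ := by
    refine measurable_pi_lambda _ fun z => ?_
    by_cases hz : z ∈ W
    · simp only [Finset.piecewise_eq_of_mem _ _ _ hz]
      exact measurable_pi_apply z
    · simp only [Finset.piecewise_eq_of_notMem _ _ _ hz]
      exact measurable_const
  have hgζm : Measurable gζ := hg.comp hpw
  have hgζB : ∀ ω, |gζ ω| ≤ Bg := fun ω => hBg _
  set Δg := Λg.filter (· ∈ W) with hΔg
  have hΔgW : Δg ⊆ W := fun z hz => (Finset.mem_filter.1 hz).2
  have hgζd : DependsOn gζ (↑Δg : Set (Site d)) := by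
    intro ω ω' h
    apply hdg
    intro z hz
    by_cases hzW : z ∈ W
    · rw [Finset.piecewise_eq_of_mem _ _ _ hzW, Finset.piecewise_eq_of_mem _ _ _ hzW]
      exact h z (Finset.mem_coe.2 (Finset.mem_filter.2 ⟨Finset.mem_coe.1 hz, hzW⟩))
    · rw [Finset.piecewise_eq_of_notMem _ _ _ hzW, Finset.piecewise_eq_of_notMem _ _ _ hzW]
  -- under both kernels `g = gζ` almost surely
  have h1 : bavg γ W g ζ = ∫ ω, gζ ω ∂(γ W ζ) := by
    unfold bavg
    refine integral_congr_ae ?_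
    filter_upwards [hγ.proper W ζ] with ω hω
    apply hdg
    intro z _
    by_cases hzW : z ∈ W
    · rw [Finset.piecewise_eq_of_mem _ _ _ hzW]
    · rw [Finset.piecewise_eq_of_notMem _ _ _ hzW, hω z hzW]
  have h2 : bavg γ W g (spinFlip y ζ) = ∫ ω, gζ ω ∂(γ W (spinFlip y ζ)) := by
    unfold bavg
    refine integral_congr_ae ?_
    filter_upwards [hγ.proper W (spinFlip y ζ)] with ω hω
    apply hdg
    intro z hz
    by_cases hzW : z ∈ W
    · rw [Finset.piecewise_eq_of_mem _ _ _ hzW]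
    · rw [Finset.piecewise_eq_of_notMem _ _ _ hzW, hω z hzW, spinFlip_apply, if_neg]
      rintro rfl
      exact hyg (Finset.mem_coe.1 hz)
  rw [h1, h2]
  by_cases hne : Δg.Nonempty
  · have hdist : D ≤ (finsetSupDist Δg {y} : ℝ) := by
      obtain ⟨z, hz, w, hw, heq⟩ := exists_finsetSupDist_eq hne (Finset.singleton_nonempty y)
      rw [Finset.mem_singleton] at hw
      rw [heq, hw]
      exact hD z (Finset.mem_filter.1 hz).1 (Finset.mem_filter.1 hz).2
    have hev : ∀ A : Set (Site d → ℤˣ), MeasurableSet A → DependsOn (· ∈ A) (↑Δg : Set (Site d)) →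
        |(γ W (spinFlip y ζ)).real A - (γ W ζ).real A| ≤ C * Real.exp (-(m * D)) := by
      intro A hA hdA
      refine (hSM Δg hΔgW y hyW (spinFlip y ζ) ζ (fun z hz => ?_) A hA hdA).trans ?_
      · rw [spinFlip_apply, if_neg hz]
      · exact mul_le_mul_of_nonneg_left (Real.exp_le_exp.2 (neg_le_neg (mul_le_mul_of_nonneg_left hdist hm)))
          hC
    exact abs_integral_sub_integral_le_of_local hgζm hgζd hgζB hev
  · -- `gζ` is constant
    rw [Finset.not_nonempty_iff_eq_empty] at hne
    have hconst : ∀ ω, gζ ω = gζ ζ := fun ω => hgζd fun z hz => by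
      rw [hne] at hz
      simp at hz
    rw [integral_congr_ae (show (fun ω => gζ ω) =ᵐ[γ W (spinFlip y ζ)] fun _ => gζ ζ from
        Eventually.of_forall hconst),
      integral_congr_ae (show (fun ω => gζ ω) =ᵐ[γ W ζ] fun _ => gζ ζ from Eventually.of_forall hconst),
      integral_const, integral_const, smul_eq_mul, smul_eq_mul, probReal_univ, probReal_univ, sub_self, abs_zero]
    positivity

/-! ### Theorem 2.7, (i) ⇒ (ii): `SMT` on the finite class from strong mixing -/

/-- Polynomial times decaying exponential tends to zero along the naturals. [folklore] -/
private theorem tendsto_const_mul_pow_mul_exp_neg {a : ℝ} (ha : 0 < a) (K : ℝ) :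
    Tendsto (fun L : ℕ => K * ((4 * (L : ℝ) + 1) ^ d * Real.exp (-(a * (L : ℝ))))) atTop (𝓝 0) := by
  have hx : Tendsto (fun L : ℕ => a * (L : ℝ) + a / 4) atTop atTop :=
    tendsto_atTop_add_const_right _ _ (Tendsto.const_mul_atTop ha tendsto_natCast_atTop_atTop)
  have h0 := (Real.tendsto_pow_mul_exp_neg_atTop_nhds_zero d).comp hx
  have heq : (fun L : ℕ => K * ((4 * (L : ℝ) + 1) ^ d * Real.exp (-(a * (L : ℝ))))) =
      fun L : ℕ => (K * ((4 / a) ^ d * Real.exp (a / 4))) *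
        ((a * (L : ℝ) + a / 4) ^ d * Real.exp (-(a * (L : ℝ) + a / 4))) := by
    funext L
    have h1 : (4 * (L : ℝ) + 1) ^ d = (4 / a) ^ d * (a * (L : ℝ) + a / 4) ^ d := by
      rw [← mul_pow]
      congr 1
      field_simp
    have h2 : Real.exp (-(a * (L : ℝ))) = Real.exp (a / 4) * Real.exp (-(a * (L : ℝ) + a / 4)) := by
      rw [← Real.exp_add]
      congr 1
      ring
    rw [h1, h2]
    ring
  rw [heq]
  simpa using tendsto_const_nhds.mul h0

/-- **[Mar99] Theorem 2.7, (i) ⇒ (ii), the finite-volume step ((2.8)–(2.11))**: if `SM(Λ, C, m)` holds for all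
multiples `Λ` of `Q_{L₀}` (`m > 0`, `L₀ > 0`), then there is `L̄` such that for every `L ≥ L̄` and every multiple
`Λ` of `Q_{L₀}` inside `B_{2L}`, `SMT(Λ, L/2, m/2)` holds (for every boundary condition).  Printed proof, p0159:
with `W = Λ_{I_f^c}` the union of the blocks of `Λ` not meeting `Λ_f` (a multiple of `Q_{L₀}`, so that (i)
applies to it), the DLR equations give `μ_Λ^τ(f; g) = μ_Λ^τ(f · (μ_W(g) − μ_Λ^τ μ_W(g)))` (2.9); the oscillation
of `σ ↦ μ_W^σ(g)` over configurations agreeing off `Λ` is telescoped over the sites of `Λ ∖ W = Λ_{I_f}` (2.10)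
and each single-site term is at most `2‖g‖ C e^{−m (d(Λ_f,Λ_g) − L₀ + 1)}` by `SM(W, C, m)`
(`abs_bavg_spinFlip_sub_le_of_strongMixing`); since `|Λ_{I_f}| ≤ |B_{2L}| = (4L+1)^d` and
`d(Λ_f, Λ_g) ≥ L/2`, the prefactor is absorbed for `L` large, giving the rate `m/2` (2.11).  Deviation from the
print: [Mar99] uses blocks of an intermediate side `l₁ ∈ [L^{2/3}, L/8]` and obtains `SMT(Λ, L/2, m/8)`; blocks
of side `L₀` suffice here, and the fact's existential constants make the difference immaterial.
[cite: Martinelli1999, Theorem 2.7] -/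
theorem SMT_of_strongMixing (U : FRPotential d ℤˣ r) (β : ℝ) {C m : ℝ} {L₀ : ℕ} (hm : 0 < m) (hL₀ : 0 < L₀)
    (hSM : ∀ Λ ∈ classF d L₀, StrongMixing (U.spec β) Λ C m) :
    ∃ Lbar : ℕ, ∀ L : ℕ, Lbar ≤ L → ∀ Λ ∈ classF d L₀, Λ ⊆ centeredCube d (2 * L) →
      SMT (U.spec β) Λ ((L : ℝ) / 2) (m / 2) := by
  classical
  have hγ := U.isSpecification_spec β
  -- `C ≥ 0` (apply (i) to the empty volume)
  have hC0 : 0 ≤ C := by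
    have hempty : (∅ : Finset (Site d)) ∈ classF d L₀ := ⟨0, fun i => ⟨le_rfl, by simp only [Pi.zero_apply]; exact_mod_cast hL₀⟩, ∅, by simp⟩
    have h := hSM ∅ hempty ∅ (Finset.empty_subset _) 0 (Finset.notMem_empty _) (fun _ => 1) (fun _ => 1)
      (fun _ _ => rfl) Set.univ MeasurableSet.univ (fun _ _ _ => rfl)
    have h0 : finsetSupDist (∅ : Finset (Site d)) {0} = 0 := by simp [finsetSupDist]
    rw [sub_self, abs_zero, h0, Nat.cast_zero, mul_zero, neg_zero, Real.exp_zero, mul_one] at h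
    exact h
  -- the threshold `L̄`
  obtain ⟨L₁, hL₁⟩ : ∃ L₁ : ℕ, ∀ L ≥ L₁,
      2 * C * Real.exp (m * (L₀ - 1)) * ((4 * (L : ℝ) + 1) ^ d * Real.exp (-(m / 4 * (L : ℝ)))) < 1 :=
    eventually_atTop.1 ((tendsto_const_mul_pow_mul_exp_neg (d := d) (by positivity : 0 < m / 4)
      (2 * C * Real.exp (m * (L₀ - 1)))).eventually (gt_mem_nhds one_pos))
  refine ⟨max L₁ (2 * L₀), fun L hL Λ hΛF hΛB => ?_⟩
  have hLL₁ : L₁ ≤ L := le_of_max_le_left hL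
  have hLL₀ : 2 * L₀ ≤ L := le_of_max_le_right hL
  obtain ⟨o, ho, I, rfl⟩ := hΛF
  set Λ := I.biUnion fun x => cubeQ L₀ (L₀ • x + o) with hΛI
  intro f g Λf Λg Bf Bg hfm hgm hdf hdg hBf hBg hDist τ
  haveI := hγ.isProbability Λ τ
  have hBf0 : 0 ≤ Bf := (abs_nonneg _).trans (hBf τ)
  have hBg0 : 0 ≤ Bg := (abs_nonneg _).trans (hBg τ)
  have hRHS0 : 0 ≤ (Λf.card : ℝ) * Λg.card * Bf * Bg * Real.exp (-(m / 2 * (finsetSupDist Λf Λg : ℝ))) := by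
    positivity
  have hif : Integrable f (U.spec β Λ τ) :=
    Integrable.of_bound hfm.aestronglyMeasurable Bf (Eventually.of_forall fun σ => by
      rw [Real.norm_eq_abs]; exact hBf σ)
  have hig : Integrable g (U.spec β Λ τ) :=
    Integrable.of_bound hgm.aestronglyMeasurable Bg (Eventually.of_forall fun σ => by
      rw [Real.norm_eq_abs]; exact hBg σ)
  -- degenerate supports: a constant observable has zero covariance
  by_cases hΛf0 : Λf = ∅
  · have hconst : ∀ σ, f σ = f τ := fun σ => hdf fun z hz => by rw [hΛf0] at hz; simp at hz
    have e1 : ∫ σ, f σ * g σ ∂(U.spec β Λ τ) = f τ * ∫ σ, g σ ∂(U.spec β Λ τ) := by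
      rw [← integral_const_mul]
      exact integral_congr_ae (Eventually.of_forall fun σ => by simp only [hconst σ])
    have e2 : ∫ σ, f σ ∂(U.spec β Λ τ) = f τ := by
      rw [integral_congr_ae (show (fun σ => f σ) =ᵐ[U.spec β Λ τ] fun _ => f τ from
        Eventually.of_forall hconst), integral_const, smul_eq_mul, probReal_univ, one_mul]
    rw [e1, e2, sub_self, abs_zero]
    exact hRHS0
  by_cases hΛg0 : Λg = ∅
  · have hconst : ∀ σ, g σ = g τ := fun σ => hdg fun z hz => by rw [hΛg0] at hz; simp at hz
    have e1 : ∫ σ, f σ * g σ ∂(U.spec β Λ τ) = (∫ σ, f σ ∂(U.spec β Λ τ)) * g τ := by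
      rw [← integral_mul_const]
      exact integral_congr_ae (Eventually.of_forall fun σ => by simp only [hconst σ])
    have e2 : ∫ σ, g σ ∂(U.spec β Λ τ) = g τ := by
      rw [integral_congr_ae (show (fun σ => g σ) =ᵐ[U.spec β Λ τ] fun _ => g τ from
        Eventually.of_forall hconst), integral_const, smul_eq_mul, probReal_univ, one_mul]
    rw [e1, e2, sub_self, abs_zero]
    exact hRHS0
  have hΛf1 : (1 : ℝ) ≤ Λf.card := by exact_mod_cast (Finset.nonempty_iff_ne_empty.2 hΛf0).card_pos
  have hΛg1 : (1 : ℝ) ≤ Λg.card := by exact_mod_cast (Finset.nonempty_iff_ne_empty.2 hΛg0).card_pos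
  -- the blocks: `S = Λ_{I_f}`, `W = Λ_{I_f^c}`
  set I' := I.filter fun x => (cubeQ L₀ (L₀ • x + o) ∩ Λf).Nonempty with hI'
  set I'' := I.filter fun x => ¬ (cubeQ L₀ (L₀ • x + o) ∩ Λf).Nonempty with hI''
  set S := I'.biUnion fun x => cubeQ L₀ (L₀ • x + o) with hS
  set W := I''.biUnion fun x => cubeQ L₀ (L₀ • x + o) with hW
  have hWΛ : W ⊆ Λ := Finset.biUnion_subset_biUnion_of_subset_left _ (Finset.filter_subset _ _)
  have hSΛ : S ⊆ Λ := Finset.biUnion_subset_biUnion_of_subset_left _ (Finset.filter_subset _ _)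
  have hΛSW : ∀ z ∈ Λ, z ∉ W → z ∈ S := by
    intro z hz hzW
    rw [hΛI] at hz
    obtain ⟨x, hx, hzx⟩ := Finset.mem_biUnion.1 hz
    by_cases hxf : (cubeQ L₀ (L₀ • x + o) ∩ Λf).Nonempty
    · exact Finset.mem_biUnion.2 ⟨x, Finset.mem_filter.2 ⟨hx, hxf⟩, hzx⟩
    · exact (hzW (Finset.mem_biUnion.2 ⟨x, Finset.mem_filter.2 ⟨hx, hxf⟩, hzx⟩)).elim
  have hWF : W ∈ classF d L₀ := ⟨o, ho, I'', rfl⟩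
  have hfW : ∀ z ∈ (↑Λf : Set (Site d)), z ∉ W := by
    intro z hz hzW
    obtain ⟨x, hx, hzx⟩ := Finset.mem_biUnion.1 hzW
    exact (Finset.mem_filter.1 hx).2 ⟨z, Finset.mem_inter.2 ⟨hzx, Finset.mem_coe.1 hz⟩⟩
  have hSW : ∀ z ∈ S, z ∉ W := by
    intro z hzS hzW
    obtain ⟨x, hx, hzx⟩ := Finset.mem_biUnion.1 hzS
    obtain ⟨x', hx', hzx'⟩ := Finset.mem_biUnion.1 hzW
    have hxx' : x ≠ x' := by
      rintro rfl
      exact (Finset.mem_filter.1 hx').2 (Finset.mem_filter.1 hx).2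
    exact Finset.disjoint_left.1 (disjoint_cubeQ hL₀ o hxx') hzx hzx'
  have hnear : ∀ z ∈ S, ∃ w ∈ Λf, supDist z w < L₀ := by
    intro z hz
    obtain ⟨x, hx, hzx⟩ := Finset.mem_biUnion.1 hz
    obtain ⟨w, hw⟩ := (Finset.mem_filter.1 hx).2
    obtain ⟨hwx, hwf⟩ := Finset.mem_inter.1 hw
    exact ⟨w, hwf, supDist_lt_of_mem_cubeQ hL₀ hzx hwx⟩
  have hScard : (S.card : ℝ) ≤ (4 * (L : ℝ) + 1) ^ d := by
    have h1 : S.card ≤ (centeredCube d (2 * L)).card := Finset.card_le_card (hSΛ.trans hΛB)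
    rw [card_centeredCube] at h1
    have h2 : (S.card : ℝ) ≤ ((2 * (2 * L) + 1 : ℕ) : ℝ) ^ d := by exact_mod_cast h1
    refine h2.trans (le_of_eq ?_)
    push_cast
    ring
  -- distances: `D = d(Λ_f, Λ_g) ≥ L/2 ≥ L₀`, every `y ∈ S` is within `L₀ − 1` of `Λ_f`
  set D : ℕ := finsetSupDist Λf Λg with hD
  have hDL₀ : (L₀ : ℝ) ≤ D := by
    have : (2 * L₀ : ℕ) ≤ (L : ℝ) := by exact_mod_cast hLL₀
    push_cast at this
    linarith
  have tri : ∀ p q s : Site d, supDist p s ≤ supDist p q + supDist q s := fun p q s => by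
    rw [supDist_le_iff]
    intro i
    have e1 := natAbs_sub_le_supDist p q i
    have e2 := natAbs_sub_le_supDist q s i
    have : p i - s i = (p i - q i) + (q i - s i) := by ring
    rw [this]
    exact (Int.natAbs_add_le _ _).trans (add_le_add e1 e2)
  have hfar : ∀ y ∈ S, ∀ z ∈ Λg, D ≤ supDist z y + (L₀ - 1) := by
    intro y hy z hz
    obtain ⟨w, hw, hyw⟩ := hnear y hy
    have h1 : D ≤ supDist w z := finsetSupDist_le hw hz
    have h2 := tri w y z
    rw [supDist_comm y w] at hyw
    rw [supDist_comm z y]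
    omega
  have hyg : ∀ y ∈ S, y ∉ Λg := by
    intro y hy hyg
    have h := hfar y hy y hyg
    rw [supDist_self, zero_add] at h
    have : (D : ℝ) ≤ ((L₀ - 1 : ℕ) : ℝ) := by exact_mod_cast h
    rw [Nat.cast_sub (by omega), Nat.cast_one] at this
    linarith
  -- the conditional expectation `G = μ_W(g)`
  set G : (Site d → ℤˣ) → ℝ := bavg (U.spec β) W g with hG
  have hGm : Measurable G := measurable_bavg hγ W hgm
  have hGB : ∀ σ, |G σ| ≤ Bg := abs_bavg_le hγ W hBg
  have hGdep : DependsOn G ((↑W : Set (Site d))ᶜ) := dependsOn_bavg hγ W hgm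
  have hiG : Integrable G (U.spec β Λ τ) :=
    Integrable.of_bound hGm.aestronglyMeasurable Bg (Eventually.of_forall fun σ => by
      rw [Real.norm_eq_abs]; exact hGB σ)
  -- DLR: `μ_Λ^τ(f g) = μ_Λ^τ(f G)` and `μ_Λ^τ(g) = μ_Λ^τ(G)`
  have hfg : ∫ σ, f σ * g σ ∂(U.spec β Λ τ) = ∫ σ, f σ * G σ ∂(U.spec β Λ τ) := by
    have hb : ∀ σ, |f σ * g σ| ≤ Bf * Bg := fun σ => by
      rw [abs_mul]
      exact mul_le_mul (hBf σ) (hBg σ) (abs_nonneg _) hBf0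
    rw [← integral_integral_spec hγ hWΛ τ (h := fun σ => f σ * g σ) (hfm.mul hgm) hb]
    refine integral_congr_ae (Eventually.of_forall fun σ => ?_)
    exact bavg_mul_of_dependsOn hγ W hdf hfW g σ
  have hgG : ∫ σ, g σ ∂(U.spec β Λ τ) = ∫ σ, G σ ∂(U.spec β Λ τ) :=
    (integral_integral_spec hγ hWΛ τ hgm hBg).symm
  -- the single-site bound `b` and the oscillation of `G` over configurations agreeing off `Λ`
  set b : ℝ := 2 * Bg * (C * Real.exp (-(m * ((D : ℝ) - (L₀ - 1))))) with hb
  have hb0 : 0 ≤ b := by positivity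
  have hsite : ∀ (ζ : Site d → ℤˣ), ∀ y ∈ S, |G (spinFlip y ζ) - G ζ| ≤ b := by
    intro ζ y hy
    refine abs_bavg_spinFlip_sub_le_of_strongMixing hγ hC0 hm.le (hSM W hWF) hgm hdg hBg (hSW y hy) (hyg y hy)
      (fun z hz _ => ?_) ζ
    have h := hfar y hy z hz
    have h' : (D : ℝ) ≤ supDist z y + ((L₀ - 1 : ℕ) : ℝ) := by exact_mod_cast h
    rw [Nat.cast_sub (by omega), Nat.cast_one] at h'
    linarith
  have hkey : ∀ σ σ' : Site d → ℤˣ, (∀ z ∉ Λ, σ z = σ' z) → |G σ' - G σ| ≤ S.card * b := by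
    intro σ σ' hagree
    have hG' : G σ' = G (S.piecewise σ' σ) := hGdep fun z hz => by
      by_cases hzS : z ∈ S
      · rw [Finset.piecewise_eq_of_mem _ _ _ hzS]
      · rw [Finset.piecewise_eq_of_notMem _ _ _ hzS]
        have hzΛ : z ∉ Λ := fun hzΛ => hzS (hΛSW z hzΛ hz)
        exact (hagree z hzΛ).symm
    rw [hG']
    refine abs_sub_le_card_mul S (fun ζ y hy s => ?_) σ σ'
    by_cases hs : s = ζ y
    · rw [hs, Function.update_eq_self, sub_self, abs_zero]
      exact hb0
    · have hflip : Function.update ζ y s = spinFlip y ζ := by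
        funext z
        rw [Function.update_apply, spinFlip_apply]
        split_ifs with hz
        · exact Int.units_ne_iff_eq_neg.1 hs
        · rfl
      rw [hflip]
      exact hsite ζ y hy
  -- `|μ_Λ^τ(f; g)| ≤ ‖f‖ |S| b`
  have hcov : |∫ σ, f σ * g σ ∂(U.spec β Λ τ) - (∫ σ, f σ ∂(U.spec β Λ τ)) * ∫ σ, g σ ∂(U.spec β Λ τ)| ≤
      Bf * (S.card * b) := by
    rw [hfg, hgG]
    set μ := U.spec β Λ τ with hμ
    set Gbar := ∫ σ, G σ ∂μ with hGbar
    have hiFG : Integrable (fun σ => f σ * G σ) μ :=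
      Integrable.of_bound (hfm.mul hGm).aestronglyMeasurable (Bf * Bg) (Eventually.of_forall fun σ => by
        rw [Real.norm_eq_abs, abs_mul]; exact mul_le_mul (hBf σ) (hGB σ) (abs_nonneg _) hBf0)
    have e : ∫ σ, f σ * G σ ∂μ - (∫ σ, f σ ∂μ) * Gbar = ∫ σ, f σ * (G σ - Gbar) ∂μ := by
      rw [← integral_mul_const Gbar, ← integral_sub hiFG (hif.mul_const Gbar)]
      refine integral_congr_ae (Eventually.of_forall fun σ => ?_)
      ring
    rw [e]
    have hae : ∀ᵐ σ ∂μ, ‖f σ * (G σ - Gbar)‖ ≤ Bf * (S.card * b) := by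
      filter_upwards [hγ.proper Λ τ] with σ hσ
      rw [Real.norm_eq_abs, abs_mul]
      refine mul_le_mul (hBf σ) ?_ (abs_nonneg _) hBf0
      have eG : G σ - Gbar = ∫ σ', (G σ - G σ') ∂μ := by
        rw [integral_sub (integrable_const _) hiG, integral_const, smul_eq_mul, probReal_univ, one_mul]
      rw [eG]
      have hae' : ∀ᵐ σ' ∂μ, ‖G σ - G σ'‖ ≤ S.card * b := by
        filter_upwards [hγ.proper Λ τ] with σ' hσ'
        rw [Real.norm_eq_abs, abs_sub_comm]
        exact hkey σ σ' fun z hz => by rw [hσ z hz, hσ' z hz]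
      have h := norm_integral_le_of_norm_le_const hae'
      rwa [probReal_univ, mul_one, Real.norm_eq_abs] at h
    have h := norm_integral_le_of_norm_le_const hae
    rwa [probReal_univ, mul_one, Real.norm_eq_abs] at h
  -- absorb the prefactor
  have hexpD : Real.exp (-(m * ((D : ℝ) - (L₀ - 1)))) =
      Real.exp (m * (L₀ - 1)) * Real.exp (-(m / 2 * (D : ℝ))) * Real.exp (-(m / 2 * (D : ℝ))) := by
    rw [← Real.exp_add, ← Real.exp_add]
    congr 1
    ring
  have hexpL : Real.exp (-(m / 2 * (D : ℝ))) ≤ Real.exp (-(m / 4 * (L : ℝ))) :=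
    Real.exp_le_exp.2 (by nlinarith [hDist, hm])
  have hX := (hL₁ L hLL₁).le
  calc |∫ σ, f σ * g σ ∂(U.spec β Λ τ) - (∫ σ, f σ ∂(U.spec β Λ τ)) * ∫ σ, g σ ∂(U.spec β Λ τ)|
      ≤ Bf * (S.card * b) := hcov
    _ = Bf * Bg * Real.exp (-(m / 2 * (D : ℝ))) *
          (2 * C * Real.exp (m * (L₀ - 1)) * (S.card * Real.exp (-(m / 2 * (D : ℝ))))) := by
        rw [hb, hexpD]; ring
    _ ≤ Bf * Bg * Real.exp (-(m / 2 * (D : ℝ))) *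
          (2 * C * Real.exp (m * (L₀ - 1)) * ((4 * (L : ℝ) + 1) ^ d * Real.exp (-(m / 4 * (L : ℝ))))) := by
        gcongr
    _ ≤ Bf * Bg * Real.exp (-(m / 2 * (D : ℝ))) * 1 := by gcongr
    _ = 1 * (Bf * Bg * Real.exp (-(m / 2 * (D : ℝ)))) := by ring
    _ ≤ ((Λf.card : ℝ) * Λg.card) * (Bf * Bg * Real.exp (-(m / 2 * (D : ℝ)))) :=
        mul_le_mul_of_nonneg_right (one_le_mul_of_one_le_of_one_le hΛf1 hΛg1) (by positivity)
    _ = _ := by ring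

/-- **[Mar99] Theorem 2.7, modulo Proposition 2.9 (effectiveness)**: if the effectiveness statement
`Martinelli1999_effectiveness U` holds (a named fact of `StrongMixingFiniteSize.lean`, [Mar99] Proposition 2.9),
then strong mixing on all multiples of some `Q_{L₀}` is EQUIVALENT to `SMT` on all multiples of some `Q_{L₀}`.
(ii) ⇒ (i) is `strongMixing_of_SMT'` (`StrongMixingOfSMT.lean`, unconditional); (i) ⇒ (ii) as printed (p0159
L1–5): choose `l = L₀ n` with `n > l̄` and `l ≥ L̄`; `SMT_of_strongMixing` gives `SMT(V, l/2, m/2)` for all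
`V ∈ 𝓕_l^0 ⊆ 𝓕_{L₀}` (a multiple of `Q_{L₀ n}` is a multiple of `Q_{L₀}`), and Proposition 2.9 upgrades this to
`SMT(V, γ₁ l, m̂)` for all `V ∈ 𝓕_l`.  The typed fact `Martinelli1999_strongMixing_iff_SMT` is thereby reduced
to `Martinelli1999_effectiveness`. [cite: Martinelli1999, Theorem 2.7] -/
theorem strongMixing_iff_SMT_of_effectiveness (U : FRPotential d ℤˣ r) (hE : Martinelli1999_effectiveness U) :
    Martinelli1999_strongMixing_iff_SMT U := by
  intro β
  constructor
  · rintro ⟨C, m, L₀, hm, hL₀, hSM⟩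
    obtain ⟨Lbar, hLbar⟩ := SMT_of_strongMixing U β hm hL₀ hSM
    obtain ⟨lbar, γ₁, mhat, -, -, hmhat, hEff⟩ := hE β (m / 2) (half_pos hm)
    set n : ℕ := max lbar Lbar + 1 with hn
    have hnn : n ≤ L₀ * n := Nat.le_mul_of_pos_left n hL₀
    have hl₁ : lbar < L₀ * n := by omega
    have hl₂ : Lbar ≤ L₀ * n := by omega
    have hl0 : 0 < L₀ * n := by omega
    refine ⟨(γ₁ : ℝ) * (L₀ * n : ℕ), mhat, L₀ * n, hmhat, hl0, fun V hV =>
      hEff (L₀ * n) hl₁ (fun V' hV' => ?_) V hV⟩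
    exact hLbar (L₀ * n) hl₂ V' (mem_classF_of_mem_classF0_mul hL₀ hV') hV'.2
  · exact strongMixing_of_SMT' U β

end Glauber

end Literature.Probability.LatticeModels

end
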